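import Summits.QuantumFields.BalabanUV.T4Continuum.Support.NE3EnergyRateWSupLines
import Summits.QuantumFields.BalabanUV.T4Continuum.Support.NE3DecomposedRepSfClassQuad
import Summits.QuantumFields.BalabanUV.T4Continuum.Support.NE3ChartLettersMono
import HarnessLib

/-!
# T⁴ programme, node NE3 — route Π, file 6bγ (ruling ρ-g26-1 (3)): THE END OF ROUTE Π OVER `sfClass` — T-E_w♯ WITH `hchart` GONE: per level ∕ datum ∕
# regular minimiser pair the hypotheses are EXACTLY the residual slice representative [leaf Π-L1♮], a square-summable weight with the LOCAL QUADRATIC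
# LETTER of the linearised average [supplied by Π-C-3γ over the path-majorant leaf (Π-REG-γ)], the LETTERS of the linear normal part [W6], and
# k-free currencies; the chart, the path, the class∕window data are theorems

NE3 (node U1b), row NE3 OWNER `b2b-balaban-t4-ne3-p1` (gen 26; ONLINE journal l.24333 item (2); ruling ρ-g26-1 l.24615 after the disprover's D-ne3r2-g12-1:
the currency of record for the quadratic remainder is the path-sum one, so this END takes the remainder as a LETTER against a square-summable weight and fixes
no currency).  Inputs BY NAME: the END `NE3EnergyRateWSupLines.ne3EnergyRateWSup_sfClass_of_lines` (g25, p243157 — (P♮)_W gone), file 5b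
`NE3ChartLettersMono.hchart_uniform_of_decomposedRep`, file 6aγ `NE3DecomposedRepSfClassQuad.decomposedRep_sfClass_of_quadLetter` (over 4γ
`NE3DecomposedRepOfQuadLetter`).

WHAT.  §1 the LETTER POLYNOMIALS of route Π as data (`piRad`, `piNu`, `piKappa1`, `piKappa2` — k-free, N-free, explicit in `d`, the quadratic-letter constant `C₂`,
the right-inverse constants `c₁..c₄`, the currencies `α̂, Ĉ, α̂N, âN` and the class radius `ε`).  §2 **`ne3EnergyRateWSup_sfClass_routePi`**:
`NE3EnergyRateWSup d (sfClass d L N ε) L N b g C′ s dom` — T-E_w♯ over the small-field class — from: the class-transport numerics, the END's class family `hsmall`,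
the K-ROAD lines `hK1`–`hK4`, FOUR uniform lines of route Π, the two level lines (J1)(J2), the regularity∕budget lines of the END with
`θ = 2(1+4√(16d+1))·piNu`, `κ = 2·piKappa1 + 912d·piKappa2`, `θ₀ = piNu + 23√2√(16d+1)(1+piNu)`, `q = 0`, AND — the only per-pair hypothesis — **`hleaves`**: at
every level `j`, datum `V ∈ dom`, minimiser `U_A` of run `j+1`, minimiser `U_B` of run `j+2` regular with `(b, g)`, THERE ARE a residual gauge `u`, a relative field
`X₀`, a linear normal part `Nn`, a sup datum `α₀`, a weight `m` with constant `C`, and sizes `αN, aN` with [leaf Π-L1♮]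
`ResidualSliceRepT L N (j+1) (cavg L U_B) U_A u X₀ Nn α₀`; the weight's square-summability `(L^{j+1})^d Σ m² ≤ C²·dirSq X₀` and THE LOCAL QUADRATIC LETTER
`‖dirIter L (j+1) (cavg L U_B) X₀ z κ‖ ≤ C₂((L^{j+1})·m z κ)²` [Π-C-3γ over (Π-REG-γ)]; the letters of `Nn` (periodic, sup, window sup-curl, (R1)–(R4) against
`dirIter L (j+1) (cavg L U_B) X₀`) [W6]; and the currencies `α₀·L^{j+1} ≤ α̂`, `m·L^{j+1} ≤ α̂`, `C ≤ Ĉ`, `αN·L^{j+1} ≤ α̂N`, `aN·(L^{j+1})² ≤ âN`.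
`Nn` is MEANT to be Π-R-W's `NE3SmoothRightInverseW.rightInvW … (dirIter L (j+1) (cavg L U_B) X₀)` (W5; exact `dirIter ∘ rightInvW = id`), generic here.

HONEST FRAMING.  A composition of landed theorems.  REMAINING HYPOTHESES OF THE LOCAL HALF OF NE3 ON THE FIXED TORUS after this file: per pair the TYPED LEAF
Π-L1♮ (B11 Prop 2 TYPE-analogue in the residual gauge, R-adapted; ours in form, NOT a quotation), the weight + local quadratic letter (kernel supplier Π-C-3γ
over the TYPED LEAF (Π-REG-γ) = B11 Thm 1∕Prop 2 regularity TYPE in path currency, ours in form — in flight), the right-inverse letters (kernel, W6 in flight),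
(H∃) downstream, and displayed k-free numeric lines; NO chart, NO path, NO fixed point, NO (ML_w), NO (P♮)_W, NO class∕window∕fibre datum.  T-E_w♯ and NE3 are
NOT proved; spine PROVED 0∕9; finite T⁴ rung (B)+1 — NOT infinite volume, NOT mass gap, NOT `BetaPertH`, NOT Clay.  PLACEMENT: `Summits/QuantumFields/BalabanUV/`.
HONEST DEPENDENCY: continuum YM on T⁴ ⇐ BetaPertH ∧ nine spine estimates (0/9 proved); BetaPertH ⇐ (D1) ∧ (D4) ∧ CAP+tail; G-an2-4 gates asym, D1 and NE2/3/4.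
-/

set_option autoImplicit false

open scoped BigOperators Matrix.Norms.L2Operator
open NormedSpace Finset

namespace Summit.QuantumFields.BalabanUV.T4Continuum.NE3EnergyRateWSupRoutePi

open Set
open Literature.MathematicalPhysics.QuantumFieldTheory.Balaban1983to89
open B7Prop1Explicit B7Prop2Explicit
open T4AveragingDeficitWall hiding Site Plane Plaq Bond
open T4AveragingDeficitWallBoundary (IsPeriodicCfg periodBox)
open AveragingDeficitPeriodicCounting (IsPeriodicDir)
open AveragingDeficitChartCalculus (cavg)
open AveragingDeficitMultiLevelPrep (LevelSmall)
open NE3CovariantLineSumsL2 (C2sq)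
open NE3CovariantLineSumsL2Tower (rho)
open MinimalActionLevels (perWin)
open MinimalActionRate (sfClass Regular)
open MinimalActionSandwich (IsMinimiser)
open NE3TangentCovariantTower (dirIter)
open NE3EnergyWeightedShapes (energyNormW)
open NE3EnergyWeightedSupShape (NE3EnergyRateWSup)
open NE3FrameFreeSliceW (frameFreeBlockLandauW)
open NE3EnergyRateWSupOfSlicePoincare (cLambda)
open NE3SlicePoincareBudgetLine (ShLine SmallYLine CPLine)
open NE3EnergyRateWSupLines (ne3EnergyRateWSup_sfClass_of_lines)
open NE3DecomposedRepOfLinearNormalPart (ResidualSliceRepT)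
open NE3DecomposedRepSfClassQuad (decomposedRep_sfClass_of_quadLetter)
open NE3ChartLettersMono (hchart_uniform_of_decomposedRep)

noncomputable section

variable {d : ℕ} {n : Type*} [Fintype n] [DecidableEq n]

/-! ## §1 The letter polynomials of route Π -/

/-- **THE UNIFORM PLAQUETTE RADIUS OF ROUTE Π** (`a·(L^{j+1})² ≤ piRad`): `3ε + 2âN + 8192(α̂+α̂N)α̂N + 48α̂² + 1300((α̂+α̂N) + (1+2048(α̂+α̂N))α̂N)²`.
[folklore] -/
def piRad (ε αh αNh aNh : ℝ) : ℝ :=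
  3 * ε + 2 * aNh + 8192 * (αh + αNh) * αNh + 48 * αh ^ 2 + 1300 * ((αh + αNh) + (1 + 2048 * (αh + αNh)) * αNh) ^ 2

/-- **THE UNIFORM ν-LETTER OF ROUTE Π**: `(1+2048√(16d+1))·2√(c₁+c₂)·C₂·Ĉ·α̂` (`C₂` = the quadratic letter's constant). [folklore] -/
def piNu (d : ℕ) (c₁ c₂ C₂ Ch αh : ℝ) : ℝ :=
  (1 + 2048 * Real.sqrt (16 * d + 1)) * (2 * Real.sqrt (c₁ + c₂) * C₂) * Ch * αh

/-- **THE UNIFORM κ₁-LETTER OF ROUTE Π**: `(4c₃ + 32768dc₄)·C₂·Ĉ²·piRad`. [folklore] -/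
def piKappa1 (d : ℕ) (c₃ c₄ C₂ Ch ε αh αNh aNh : ℝ) : ℝ :=
  (4 * c₃ + 32768 * d * c₄) * C₂ * Ch ^ 2 * piRad ε αh αNh aNh

/-- **THE UNIFORM κ₂-LETTER OF ROUTE Π**: `7224c₄·C₂·Ĉ²·piRad`. [folklore] -/
def piKappa2 (c₄ C₂ Ch ε αh αNh aNh : ℝ) : ℝ :=
  7224 * c₄ * C₂ * Ch ^ 2 * piRad ε αh αNh aNh

/-- `piNu` is non-negative for non-negative `C₂`, `Ĉ`, `α̂`. [folklore] -/
theorem piNu_nonneg {c₁ c₂ C₂ Ch αh : ℝ} (hC₂ : 0 ≤ C₂) (hCh : 0 ≤ Ch) (hαh : 0 ≤ αh) : 0 ≤ piNu d c₁ c₂ C₂ Ch αh := by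
  unfold piNu
  have : 0 ≤ Real.sqrt (c₁ + c₂) := Real.sqrt_nonneg _
  positivity

/-! ## §2 THE END of route Π over `sfClass` -/

/-- **T-E_w♯ OVER `sfClass` FROM THE RESIDUAL SLICE REPRESENTATIVE, THE LOCAL QUADRATIC LETTER AND THE RIGHT-INVERSE LETTERS — `hchart` IS NO LONGER A
HYPOTHESIS.**  See the module docstring for the reading of every hypothesis; `θ = 2(1+4√(16d+1))·piNu`, `κ = 2·piKappa1 + 912d·piKappa2`,
`θ₀ = piNu + 23√2√(16d+1)(1+piNu)`, `q = 0`. [folklore] -/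
theorem ne3EnergyRateWSup_sfClass_routePi [Nonempty n] (hd : 3 ≤ d) {L N : ℕ} [NeZero L] [NeZero N] (hL : 2 ≤ L) (hN : 1 ≤ N)
    {ε b g : ℝ} (hb : 0 ≤ b) (hbε : b < ε) (hg : 0 < g)
    (hbs : 512 * (d + 1) * (d + 4) * (L : ℝ) ^ 2 * b ≤ 1) (hbε' : b + 226 * (8 * (d + 1) * (d + 4)) ^ 2 * b ^ 2 ≤ ε)
    (hsmall : ∀ j : ℕ, LevelSmall d L (j + 1) (ε / ((L : ℝ) ^ (j + 2)) ^ 2))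
    -- the K-road lines of (P♮)_W
    {dom : Set (Site d → Fin d → (Matrix n n ℂ)ˣ)} {θK εc : ℝ} (hε : 0 < ε) (hεθ : ε ≤ θK) (hεc : 0 < εc)
    (hK1 : ShLine d L (Fintype.card n) εc θK ≤ 1 / 2) (hK2 : SmallYLine d L (Fintype.card n) εc θK ≤ 1 / 2)
    (hK3 : 68 / 3 * (((d : ℝ) + 1) * ((d : ℝ) + 4)) * C2sq d L * θK ≤ rho d L / 2)
    (hK4 : 8 * d * (((d : ℝ) - 1) * θK) ^ 2
      + 2 * ((Fintype.card n : ℝ) * ((4 * (d : ℝ) ^ 2 + 272 * d * (((d : ℝ) + 1) * ((d : ℝ) + 4))) * θK) ^ 2) ≤ 1 / 2)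
    -- route Π: the quadratic-letter constant, the right-inverse constants, the currencies' ceilings and FOUR uniform lines
    {C₂ c₁ c₂ c₃ c₄ αh Ch αNh aNh Λ : ℝ} (hC₂ : 0 ≤ C₂) (hc₁ : 0 ≤ c₁) (hc₂ : 0 ≤ c₂) (hc₃ : 0 ≤ c₃) (hc₄ : 0 ≤ c₄)
    (hαh0 : 0 ≤ αh) (hCh0 : 0 ≤ Ch)
    (hℓ₁ : αh ≤ 1 / 100) (hℓ₃ : αNh ≤ 1 / 2700) (hℓ₄ : 10 * (αh + 24 * αNh) ≤ 1) (hℓ₅ : 2 * (c₁ + c₂) * C₂ ^ 2 * Ch ^ 2 * αh ^ 2 ≤ 1 / 2)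
    -- the level lines (J1)(J2), the regularity and budget lines of the END
    (hCP : 0 ≤ CPLine d L (Fintype.card n) εc θK)
    (hJ1 : (1 + 480 * Real.sqrt d * (αh + 24 * αNh)) ^ 2 + 48 * d * piRad ε αh αNh aNh ≤ Λ)
    (hJ2 : 112 * (d : ℝ) * piRad ε αh αNh aNh * CPLine d L (Fintype.card n) εc θK ≤ 1 / (2 * (Fintype.card n : ℝ)))
    (hreg₁ : CPLine d L (Fintype.card n) εc θK * (Real.sqrt Λ - 1) ^ 2 ≤ 1 / 4)
    (hbudget : 2 * Λ * (2 * (1 + 4 * Real.sqrt (16 * d + 1)) * piNu d c₁ c₂ C₂ Ch αh)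
        + Λ * (2 * (1 + 4 * Real.sqrt (16 * d + 1)) * piNu d c₁ c₂ C₂ Ch αh) ^ 2
        + (2 * piKappa1 d c₃ c₄ C₂ Ch ε αh αNh aNh + 912 * d * piKappa2 c₄ C₂ Ch ε αh αNh aNh) + 2 * 0
      ≤ cLambda n (CPLine d L (Fintype.card n) εc θK) Λ / 2)
    -- THE RESIDUAL SLICE REPRESENTATIVE, THE WEIGHT WITH ITS QUADRATIC LETTER, THE LETTERS OF THE LINEAR NORMAL PART, THE CURRENCIES — per pair
    (hleaves : ∀ j : ℕ, ∀ V ∈ dom, ∀ UA UB : Site d → Fin d → (Matrix n n ℂ)ˣ,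
      IsMinimiser d (sfClass d L N ε) L N (j + 1) V UA → IsMinimiser d (sfClass d L N ε) L N (j + 2) V UB →
        Regular d L N b g (j + 2) UB →
        ∃ (u : Site d → (Matrix n n ℂ)ˣ) (X₀ Nn : Site d → Fin d → Matrix n n ℂ) (α₀ : ℝ) (m : Site d → Fin d → ℝ) (C αN aN : ℝ),
          ResidualSliceRepT L N (j + 1) (cavg L UB) UA u X₀ Nn α₀ ∧
          (∀ z κ, 0 ≤ m z κ) ∧ 0 ≤ C ∧
          ((L : ℝ) ^ (j + 1)) ^ d * ∑ z ∈ periodBox (d := d) N, ∑ κ : Fin d, m z κ ^ 2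
            ≤ C ^ 2 * dirSq X₀ (periodBox (d := d) (N * L ^ (j + 1))) ∧
          (∀ z ∈ periodBox (d := d) N, ∀ κ : Fin d,
            ‖dirIter L (j + 1) (cavg L UB) X₀ z κ‖ ≤ C₂ * ((L : ℝ) ^ (j + 1) * m z κ) ^ 2) ∧
          IsPeriodicDir Nn ((N * L ^ (j + 1) : ℕ) : ℤ) ∧ 0 ≤ αN ∧ (∀ y μ, ‖Nn y μ‖ ≤ αN) ∧ 0 ≤ aN ∧
          (∀ p ∈ perWin d (N * L ^ (j + 1)), ‖curl (cavg L UB) Nn p‖ ≤ aN) ∧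
          dirSq Nn (periodBox (d := d) (N * L ^ (j + 1)))
            ≤ c₁ * (((L : ℝ) ^ (j + 1)) ^ d / ((L : ℝ) ^ (j + 1)) ^ 2) * dirSq (dirIter L (j + 1) (cavg L UB) X₀) (periodBox (d := d) N) ∧
          curlSq (cavg L UB) Nn (periodBox (d := d) (N * L ^ (j + 1)))
            ≤ c₂ * (((L : ℝ) ^ (j + 1)) ^ d / ((L : ℝ) ^ (j + 1)) ^ 4) * dirSq (dirIter L (j + 1) (cavg L UB) X₀) (periodBox (d := d) N) ∧
          (∑ p ∈ perWin d (N * L ^ (j + 1)), ‖curl (cavg L UB) Nn p‖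
            ≤ c₃ * (((L : ℝ) ^ (j + 1)) ^ d / ((L : ℝ) ^ (j + 1)) ^ 2) * dirL1 (dirIter L (j + 1) (cavg L UB) X₀) (periodBox (d := d) N)) ∧
          dirL1 Nn (periodBox (d := d) (N * L ^ (j + 1)))
            ≤ c₄ * (((L : ℝ) ^ (j + 1)) ^ d / (L : ℝ) ^ (j + 1)) * dirL1 (dirIter L (j + 1) (cavg L UB) X₀) (periodBox (d := d) N) ∧
          α₀ * (L : ℝ) ^ (j + 1) ≤ αh ∧ (∀ z κ, m z κ * (L : ℝ) ^ (j + 1) ≤ αh) ∧ C ≤ Ch ∧ αN * (L : ℝ) ^ (j + 1) ≤ αNh ∧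
          aN * ((L : ℝ) ^ (j + 1)) ^ 2 ≤ aNh) :
    NE3EnergyRateWSup d (sfClass d L N ε) L N b g
      ((1 + (piNu d c₁ c₂ C₂ Ch αh + 23 * Real.sqrt 2 * Real.sqrt (16 * d + 1) * (1 + piNu d c₁ c₂ C₂ Ch αh)))
        * (4 / cLambda n (CPLine d L (Fintype.card n) εc θK) Λ)
        * (Real.sqrt ((L : ℝ) ^ (d - 2))
            + (Real.sqrt ((L : ℝ) ^ (d - 2)) * Real.sqrt (8 * Fintype.card (T4AveragingDeficitWall.Plane d))
                * (128 * (d * (L : ℝ) ^ 2))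
              + 2 * (2048 * ((d : ℝ) + 4) ^ 2 * (L : ℝ) ^ 2 * Real.sqrt (d * (L : ℝ) ^ d))) * b
            + b ^ 2 * (2 * (L : ℝ) ^ (d - 1) + 2 * (8 * d * (L : ℝ) ^ d)) * Real.sqrt (d / (g * (L : ℝ) ^ (d + 2)))))
      ((Real.sqrt Λ - 1) / (24 * Real.sqrt d)) dom := by
  have hL1 : 1 ≤ L := by omega
  have hν0 : 0 ≤ piNu d c₁ c₂ C₂ Ch αh := piNu_nonneg hC₂ hCh0 hαh0
  have hθ₀ : 0 ≤ piNu d c₁ c₂ C₂ Ch αh + 23 * Real.sqrt 2 * Real.sqrt (16 * d + 1) * (1 + piNu d c₁ c₂ C₂ Ch αh) := by positivity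
  -- the per-pair clause of file 5b from file 6aγ
  have hrep : ∀ j : ℕ, ∀ V ∈ dom, ∀ UA UB : Site d → Fin d → (Matrix n n ℂ)ˣ,
      (IsMinimiser d (sfClass d L N ε) L N (j + 1) V UA ∧ IsMinimiser d (sfClass d L N ε) L N (j + 2) V UB ∧
        Regular d L N b g (j + 2) UB) →
      IsUnitaryCfg (cavg L UB) ∧
      ∃ (u : Site d → (Matrix n n ℂ)ˣ) (X Nn : Site d → Fin d → Matrix n n ℂ) (α αN ν κ₁ κ₂ a : ℝ),
        NE3ProductPathChart.DecomposedRep (sfClass d L N ε) L N (j + 1) V UA UB u X Nn α αN ν κ₁ κ₂ a ∧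
        ν ≤ piNu d c₁ c₂ C₂ Ch αh ∧ κ₁ ≤ piKappa1 d c₃ c₄ C₂ Ch ε αh αNh aNh ∧ κ₂ ≤ piKappa2 c₄ C₂ Ch ε αh αNh aNh ∧
        α ≤ 1 / 40 ∧ αN ≤ 1 / 100 ∧
        (1 + 24 * Real.sqrt d * (Real.exp (10 * (α + αN)) - 1) * (L : ℝ) ^ (j + 1)) ^ 2 + 48 * d * a * ((L : ℝ) ^ (j + 1)) ^ 2 ≤ Λ ∧
        112 * (d : ℝ) * a * CPLine d L (Fintype.card n) εc θK * ((L : ℝ) ^ (j + 1)) ^ 2 ≤ 1 / (2 * (Fintype.card n : ℝ)) := by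
    rintro j V hV UA UB ⟨hA, hB, hreg⟩
    obtain ⟨u, X₀, Nn, α₀, m, C, αN, aN, h, hm0, hC, hsq, hφ, hNP, hαN0, hNsup, haN0, haN, hR1, hR2, hR3, hR4, hαh, hmh, hCh, hαNh,
      haNh⟩ := hleaves j V hV UA UB hA hB hreg
    exact decomposedRep_sfClass_of_quadLetter hL1 hN hb hε.le hbs hbε' j hA hB hreg h hm0 hC hC₂ hsq hφ hNP hαN0 hNsup haN0 haN
      hc₁ hc₂ hc₃ hc₄ hR1 hR2 hR3 hR4 hαh hmh hCh hαNh haNh hℓ₁ hℓ₃ hℓ₄ hℓ₅ hCP hJ1 hJ2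
  have hchart := hchart_uniform_of_decomposedRep (𝒞 := sfClass d L N ε) hL1 hN
    (P := fun j V UA UB => IsMinimiser d (sfClass d L N ε) L N (j + 1) V UA ∧ IsMinimiser d (sfClass d L N ε) L N (j + 2) V UB ∧
      Regular d L N b g (j + 2) UB) hrep
  exact ne3EnergyRateWSup_sfClass_of_lines hd hL hN hb hbε hg hbs hbε' hsmall hε hεθ hεc hK1 hK2 hK3 hK4
    hCP hreg₁ hθ₀ hbudget fun j V hV UA UB hA hB hreg => hchart j V hV UA UB ⟨hA, hB, hreg⟩

end

end Summit.QuantumFields.BalabanUV.T4Continuum.NE3EnergyRateWSupRoutePi
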